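import Summits.QuantumFields.YangMills.Theorems.FluctuationComparisonRegPrIntLS2BetaBlockPairReadCover
import HarnessLib

/-!
# S2β · THE SUP CHAIN — PARENT-BOX READ COVER ((k2′)): `Σ_B ‖𝟙[PBOX^r_t(B)]·g‖² ≤ (2·d·(2(r+3)+1)^d)·Σ_B ‖𝟙[READ′_{t−1}(B)]·g‖²` for every bond function `g`
# at the PARENT level `J+t` — the parent feedback columns of the ρ̃ letter (`mA`, `ρA`: relative LIFT chords ∕ lift curvature) are `S′`-shares via px20's ✓`mShare_le`

Cell `ym3-torus` (YM ladder rung R3 = continuum `SU(2)` Yang–Mills on the three-torus at fixed lattice data — a RUNG: NOT d = 4, NOT infinite volume,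
NOT a mass gap, NOT Clay).  Width seat «width 21» `ym3-torus-px21` (gen 25), FREE px helper on crux `stmt-QuantumFields-20520`
(`…Theses.UnitScaleTilt.FluctuationComparisonRegPrIntL`), LINE g18-1 S2β.  Companion of ✓p836161 `…BlockPairReadCover` one level up, for px12 g26's ρ̃-column budget
(FILE P ✓p836058 `ρt := ρS + ρA + 2(4sU+aU)mA + 2(4sA+aA)mA`; R∕R′ the lift-curvature column): the feedback letters `mA(t,B)` (relative LIFT chords on the block-pair box)
and the σ²-part of `ρA(t,B)` are controlled by PARENT-level relative chords on a bounded stencil around the parent copy of the box's blocks; this file proves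
that such parent-box Pi-sups are read by the PARENT READ′ sets `READ′_{t−1}(B′)` — written at level `J+t` EXACTLY as px20 g24's parent Pi-sup `M(t,B)` of
✓p835795 `discRow'` ∕ ✓`mShare_le` — of the top bonds `B′` within `r+3` of `B`; hence `Σ_B (parent-box sup)² ≤ C′_adj·Σ_B M(t,B)²` and `Σ_t L^t·Σ_B M(t,B)² ≤ L·S′`
(✓`mShare_le`): a β-share.  `--kind proof --supports stmt-QuantumFields-20520 --as helper`, count-neutral, DEFINITION-FREE (0 `def`, 0 `instance`, 0 `notation`,
0 `sorry`, default heartbeats).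

WHAT IS PROVED (sorry-free).  ★★★`sum_sq_parentBoxSup_le_readSup (J t r) (g)` — radius `r` generic (the consumer's stencil: `r = 1` for the `2×2` parent cell of a Whitney
hat, `r = 2` with one more neighbour), constant `2·d·(2(r+3)+1)^d`.  Tools: ✓p836161 §1 (`natAbs_rel_blockIter_le_three_of_box`, `card_bonds_nearBox_le`), ✓`natAbs_rel_le_add`,
✓`natAbs_rel_blockIter_mono`, ✓`natAbs_rel_siteShift`, ✓`blockIter_succ_eq_siteShift` (one absorbed fine level), lit `siteShift_siteShift`, `bondShift_src∕tgt`.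

HONEST SCOPE.  Finite torus bookkeeping; nothing of Bałaban's renormalisation-group analysis is asserted or proved ([Balaban1987RG1] (0.1)–(0.4) pp.251–253 are the
printed lattice conventions; [Balaban1985Averaging] Prop. 4 (128)–(135) the sup recursion the stations transcribe); the ρ̃-column budget, (SRC), `hArc`, (ST⁗)∕LOC⁗,
GAP♯∘ (`stub_uniformFibreGapOrbit`, registry 3732b7df UNTOUCHED), the five registered stubs (0∕5), S2β, 20520, 19936, 19200, `YM3TorusSU2` are NOT proved; no registered
stub is closed; rung R3 — NOT d = 4, NOT infinite volume, NOT a mass gap, NOT Clay; the Yang–Mills mass gap is NOT proved.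
-/

set_option autoImplicit false

namespace Summit.QuantumFields.YangMills.Theorems.FluctuationComparisonRegPrIntLS2BetaParentBoxReadCover

open Finset
open Literature.MathematicalPhysics.QuantumFieldTheory.Balaban1983to89
open T4Continuum T3ContinuumYM3Torus T3TiltDescent T3LevelShift BlockAveraging
open B10Eq27TorusAxialLog (rel rel_apply rel_self)
open Summit.QuantumFields.YangMills.Theorems.FluctuationComparisonRegPrIntLS2BetaReadNesting (natAbs_rel_le_add natAbs_rel_comm)
open Summit.QuantumFields.YangMills.Theorems.FluctuationComparisonRegPrIntLS2BetaTorusCellClasses (natAbs_rel_blockOf_le natAbs_rel_blockIter_mono card_box_le)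
open Summit.QuantumFields.YangMills.Theorems.FluctuationComparisonRegPrIntLS2BetaLiftLadderCombRowTower (natAbs_rel_siteShift)
open Summit.QuantumFields.YangMills.Theorems.FluctuationComparisonRegPrIntLS2BetaSupTowerOfLiftLadderNested (blockIter_succ_eq_siteShift)
open Summit.QuantumFields.YangMills.Theorems.FluctuationComparisonRegPrIntLS2BetaBlockPairReadCover (natAbs_rel_blockIter_le_three_of_box card_bonds_nearBox_le)

section Cover

variable {F : T3Family}

/-- ★★★ **PARENT-BOX READ COVER** ((k2′), the one-level-up twin of ✓p836161 `sum_sq_boxSup_le_readSup`): for ANY bond function `g` at the PARENT level `J+t` and any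
radius `r`, `Σ_B ‖𝟙[PBOX^r_t(B)]·g‖² ≤ (2·d·(2(r+3)+1)^d)·Σ_B ‖𝟙[READ′_{t−1}(B)]·g‖²`, where `READ′_{t−1}(B)` is written at level `J+t` EXACTLY as px20 g24's parent Pi-sup
`M(t,B)` predicate (✓p835795 `discRow'` ∕ ✓`mShare_le` text VERBATIM: `∃ z, blockIter t z ∈ {(σB).src, (σB).tgt} ∧ ∀ ν, |rel z ℓ′.src|_ν ≤ 2`) and
`PBOX^r_t(B)(c) := ∃ ℓ′ ∈ BOX_t(B)` (✓p836161's text VERBATIM) `, ∀ ν, |rel (σ₀₁⁻¹(blockOf ℓ′.src)) c.src|_ν ≤ r` — the parent bonds within `r` of the parent-level copy of the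
block of a box bond (the stencil a Whitney lift ∕ a parent comparison reads; `r` generic).  With `g :=` the station's level-`J+t` relative log field this is
`Σ_B δC_par(t,B)² ≤ C′_adj·Σ_B M(t,B)²`, and `Σ_t L^t·Σ_B M(t,B)² ≤ L·S′` is ✓`mShare_le` — the parent feedback columns (px12 g26's `mA`, `ρA`) are `S′`-shares.  Mechanism:
the parent copy `zp` of `blockOf z` (`z` the READ′ witness of the box bond) satisfies `blockIter t zp = σ′(B-end)` (✓`blockIter_succ_eq_siteShift`) and is within `3` of the
stencil centre (✓`natAbs_rel_blockIter_le_three_of_box` at `n = 1`, read through `σ₀₁`), so `c` — read by `B′ := ⟨σ′⁻¹(blockIter t c.src), 0⟩` with witness `c.src` — has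
`B′` within `r+3` of an endpoint of `B`; ✓`card_bonds_nearBox_le`. [cite: Balaban1987RG1, (0.1)-(0.4) p.251-253; Balaban1985Averaging, Prop. 4 (128)-(135) p.37-38] -/
theorem sum_sq_parentBoxSup_le_readSup {E : Type*} [SeminormedAddCommGroup E] (J t r : ℕ) (g : PBond (F.P (J + t)) 0 → E) :
    ∑ B : PBond (F.P J) 0, ‖(fun c : PBond (F.P (J + t)) 0 =>
        if ∃ ℓ' : PBond (F.P (J + (t + 1))) 0, (∃ ℓ'' : PBond (F.P (J + (t + 1))) 0, (∃ z : Site (F.P (J + (t + 1))) 0,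
                (B14.Eq22Determines.blockIter (t + 1) z = (bondShift (F.sitesPerDir_eq (m := F.m) (K := J) (j := 0) (m' := F.m) (K' := J + (t + 1)) (j' := t + 1) (by omega)) B).src ∨ B14.Eq22Determines.blockIter (t + 1) z = (bondShift (F.sitesPerDir_eq (m := F.m) (K := J) (j := 0) (m' := F.m) (K' := J + (t + 1)) (j' := t + 1) (by omega)) B).tgt) ∧
                ∀ ν, (B10Eq27TorusAxialLog.rel z ℓ''.src ν).natAbs ≤ 2) ∧
                (blockOf ℓ'.src = (blockOf ℓ''.src).unshift ℓ''.dir ∨ blockOf ℓ'.src = blockOf ℓ''.src ∨ blockOf ℓ'.src = (blockOf ℓ''.src).shift ℓ''.dir)) ∧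
                ∀ ν, (B10Eq27TorusAxialLog.rel ((siteShift (F.sitesPerDir_eq (m := F.m) (K := J + t) (j := 0) (m' := F.m) (K' := J + (t + 1)) (j' := 1) (by omega))).symm (blockOf ℓ'.src)) c.src ν).natAbs ≤ r
        then g c else 0)‖ ^ 2 ≤
      ((2 * (F.P J).d * (2 * (r + 3) + 1) ^ (F.P J).d : ℕ) : ℝ) * ∑ B : PBond (F.P J) 0, ‖(fun ℓ' : PBond (F.P (J + t)) 0 =>
        if ∃ z : Site (F.P (J + t)) 0,
                (B14.Eq22Determines.blockIter t z = (bondShift (F.sitesPerDir_eq (m := F.m) (K := J) (j := 0) (m' := F.m) (K' := J + t) (j' := t) (by omega)) B).src ∨ B14.Eq22Determines.blockIter t z = (bondShift (F.sitesPerDir_eq (m := F.m) (K := J) (j := 0) (m' := F.m) (K' := J + t) (j' := t) (by omega)) B).tgt) ∧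
                ∀ ν, (B10Eq27TorusAxialLog.rel z ℓ'.src ν).natAbs ≤ 2
        then g ℓ' else 0)‖ ^ 2 := by
  classical
  -- level identifications and standing ranges
  have P₁ : (F.P J).sitesPerDir 0 = (F.P (J + (t + 1))).sitesPerDir (t + 1) := F.sitesPerDir_eq (by omega)
  have P₁' : (F.P J).sitesPerDir 0 = (F.P (J + t)).sitesPerDir t := F.sitesPerDir_eq (by omega)
  have H : (F.P (J + t)).sitesPerDir 0 = (F.P (J + (t + 1))).sitesPerDir 1 := F.sitesPerDir_eq (by omega)
  have Ht : (F.P (J + t)).sitesPerDir t = (F.P (J + (t + 1))).sitesPerDir (t + 1) := F.sitesPerDir_eq (by omega)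
  have h1K : 1 ≤ (F.P (J + (t + 1))).m + (F.P (J + (t + 1))).K := by show 1 ≤ F.m + (J + (t + 1)); omega
  have htK : t ≤ (F.P (J + t)).m + (F.P (J + t)).K := by show t ≤ F.m + (J + t); omega
  have hd : 0 < (F.P J).d := (F.P J).hd
  -- the parent READ′ Pi-sups
  set R : PBond (F.P J) 0 → ℝ := fun B' => ‖(fun ℓ' : PBond (F.P (J + t)) 0 =>
        if ∃ z : Site (F.P (J + t)) 0,
                (B14.Eq22Determines.blockIter t z = (bondShift (F.sitesPerDir_eq (m := F.m) (K := J) (j := 0) (m' := F.m) (K' := J + t) (j' := t) (by omega)) B').src ∨ B14.Eq22Determines.blockIter t z = (bondShift (F.sitesPerDir_eq (m := F.m) (K := J) (j := 0) (m' := F.m) (K' := J + t) (j' := t) (by omega)) B').tgt) ∧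
                ∀ ν, (B10Eq27TorusAxialLog.rel z ℓ'.src ν).natAbs ≤ 2
        then g ℓ' else 0)‖ with hR
  have hR0 : ∀ B', 0 ≤ R B' := fun B' => norm_nonneg _
  -- adjacency: `B′.dir = 0` and `B′.src` within `r+3` of an endpoint of `B`
  let adj : PBond (F.P J) 0 → PBond (F.P J) 0 → Prop := fun B B' =>
    B'.dir = ⟨0, hd⟩ ∧ ((∀ ν, (rel B.src B'.src ν).natAbs ≤ r + 3) ∨ (∀ ν, (rel B.tgt B'.src ν).natAbs ≤ r + 3))
  -- STEP 1: per `B`, the parent-box sup is read by the adjacent top bonds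
  have h1 : ∀ B : PBond (F.P J) 0, ‖(fun c : PBond (F.P (J + t)) 0 =>
        if ∃ ℓ' : PBond (F.P (J + (t + 1))) 0, (∃ ℓ'' : PBond (F.P (J + (t + 1))) 0, (∃ z : Site (F.P (J + (t + 1))) 0,
                (B14.Eq22Determines.blockIter (t + 1) z = (bondShift (F.sitesPerDir_eq (m := F.m) (K := J) (j := 0) (m' := F.m) (K' := J + (t + 1)) (j' := t + 1) (by omega)) B).src ∨ B14.Eq22Determines.blockIter (t + 1) z = (bondShift (F.sitesPerDir_eq (m := F.m) (K := J) (j := 0) (m' := F.m) (K' := J + (t + 1)) (j' := t + 1) (by omega)) B).tgt) ∧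
                ∀ ν, (B10Eq27TorusAxialLog.rel z ℓ''.src ν).natAbs ≤ 2) ∧
                (blockOf ℓ'.src = (blockOf ℓ''.src).unshift ℓ''.dir ∨ blockOf ℓ'.src = blockOf ℓ''.src ∨ blockOf ℓ'.src = (blockOf ℓ''.src).shift ℓ''.dir)) ∧
                ∀ ν, (B10Eq27TorusAxialLog.rel ((siteShift (F.sitesPerDir_eq (m := F.m) (K := J + t) (j := 0) (m' := F.m) (K' := J + (t + 1)) (j' := 1) (by omega))).symm (blockOf ℓ'.src)) c.src ν).natAbs ≤ r
        then g c else 0)‖ ^ 2 ≤ ∑ B' ∈ univ.filter (adj B), R B' ^ 2 := by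
    intro B
    set S : ℝ := ∑ B' ∈ univ.filter (adj B), R B' ^ 2 with hS
    have hS0 : 0 ≤ S := sum_nonneg fun B' _ => sq_nonneg _
    suffices hsup : ‖(fun c : PBond (F.P (J + t)) 0 =>
        if ∃ ℓ' : PBond (F.P (J + (t + 1))) 0, (∃ ℓ'' : PBond (F.P (J + (t + 1))) 0, (∃ z : Site (F.P (J + (t + 1))) 0,
                (B14.Eq22Determines.blockIter (t + 1) z = (bondShift (F.sitesPerDir_eq (m := F.m) (K := J) (j := 0) (m' := F.m) (K' := J + (t + 1)) (j' := t + 1) (by omega)) B).src ∨ B14.Eq22Determines.blockIter (t + 1) z = (bondShift (F.sitesPerDir_eq (m := F.m) (K := J) (j := 0) (m' := F.m) (K' := J + (t + 1)) (j' := t + 1) (by omega)) B).tgt) ∧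
                ∀ ν, (B10Eq27TorusAxialLog.rel z ℓ''.src ν).natAbs ≤ 2) ∧
                (blockOf ℓ'.src = (blockOf ℓ''.src).unshift ℓ''.dir ∨ blockOf ℓ'.src = blockOf ℓ''.src ∨ blockOf ℓ'.src = (blockOf ℓ''.src).shift ℓ''.dir)) ∧
                ∀ ν, (B10Eq27TorusAxialLog.rel ((siteShift (F.sitesPerDir_eq (m := F.m) (K := J + t) (j := 0) (m' := F.m) (K' := J + (t + 1)) (j' := 1) (by omega))).symm (blockOf ℓ'.src)) c.src ν).natAbs ≤ r
        then g c else 0)‖ ≤ Real.sqrt S by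
      calc _ ≤ Real.sqrt S ^ 2 := pow_le_pow_left₀ (norm_nonneg _) hsup 2
        _ = S := Real.sq_sqrt hS0
    refine (pi_norm_le_iff_of_nonneg (Real.sqrt_nonneg S)).mpr fun c => ?_
    by_cases hb : ∃ ℓ' : PBond (F.P (J + (t + 1))) 0, (∃ ℓ'' : PBond (F.P (J + (t + 1))) 0, (∃ z : Site (F.P (J + (t + 1))) 0,
                (B14.Eq22Determines.blockIter (t + 1) z = (bondShift (F.sitesPerDir_eq (m := F.m) (K := J) (j := 0) (m' := F.m) (K' := J + (t + 1)) (j' := t + 1) (by omega)) B).src ∨ B14.Eq22Determines.blockIter (t + 1) z = (bondShift (F.sitesPerDir_eq (m := F.m) (K := J) (j := 0) (m' := F.m) (K' := J + (t + 1)) (j' := t + 1) (by omega)) B).tgt) ∧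
                ∀ ν, (B10Eq27TorusAxialLog.rel z ℓ''.src ν).natAbs ≤ 2) ∧
                (blockOf ℓ'.src = (blockOf ℓ''.src).unshift ℓ''.dir ∨ blockOf ℓ'.src = blockOf ℓ''.src ∨ blockOf ℓ'.src = (blockOf ℓ''.src).shift ℓ''.dir)) ∧
                ∀ ν, (B10Eq27TorusAxialLog.rel ((siteShift (F.sitesPerDir_eq (m := F.m) (K := J + t) (j := 0) (m' := F.m) (K' := J + (t + 1)) (j' := 1) (by omega))).symm (blockOf ℓ'.src)) c.src ν).natAbs ≤ r
    · rw [if_pos hb]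
      obtain ⟨ℓ', ⟨ℓ'', ⟨z, hzB, hz2⟩, hbox⟩, hr⟩ := hb
      -- the parent copies of `blockOf z` and of the stencil centre
      set zp : Site (F.P (J + t)) 0 := (siteShift H).symm (blockOf z) with hzp
      set y' : Site (F.P (J + t)) 0 := (siteShift H).symm (blockOf ℓ'.src) with hy'
      have hxz : blockOf z = siteShift H zp := ((siteShift H).apply_symm_apply (blockOf z)).symm
      have hxy : blockOf ℓ'.src = siteShift H y' := ((siteShift H).apply_symm_apply (blockOf ℓ'.src)).symm
      -- `|rel zp y′| ≤ 3` (the box is within 3 blocks), hence `|rel zp c.src| ≤ r + 3`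
      have h3 : ∀ ν, (rel zp y' ν).natAbs ≤ 3 := by
        intro ν
        have e := natAbs_rel_siteShift H zp y' ν
        rw [← hxz, ← hxy] at e
        have h13 := natAbs_rel_blockIter_le_three_of_box (le_refl 1) h1K z ℓ''.src ℓ'.src ℓ''.dir hz2 hbox ν
        exact e.symm.le.trans h13
      have hrc : ∀ ν, (rel zp c.src ν).natAbs ≤ r + 3 := fun ν =>
        (natAbs_rel_le_add zp y' c.src ν).trans (by rw [Nat.add_comm r 3]; exact Nat.add_le_add (h3 ν) (hr ν))
      have hdist : ∀ ν, (rel (B14.Eq22Determines.blockIter t zp) (B14.Eq22Determines.blockIter t c.src) ν).natAbs ≤ r + 3 := fun ν =>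
        natAbs_rel_blockIter_mono (Nat.zero_le t) htK zp c.src ν (hrc ν)
      -- `blockIter (t+1) z = σ_t (blockIter t zp)` (one absorbed fine level)
      have hsucc : B14.Eq22Determines.blockIter (t + 1) z = siteShift Ht (B14.Eq22Determines.blockIter t zp) :=
        blockIter_succ_eq_siteShift (K₁ := J + t) zp z hxz t
      -- the reading top bond
      let y₀ : Site (F.P (J + t)) t := B14.Eq22Determines.blockIter t c.src
      let B₀ : PBond (F.P J) 0 := ⟨(siteShift P₁').symm y₀, ⟨0, hd⟩⟩
      have hsrc : (bondShift P₁' B₀).src = y₀ := by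
        rw [bondShift_src]; exact (siteShift P₁').apply_symm_apply y₀
      have hread : ∃ z : Site (F.P (J + t)) 0,
                (B14.Eq22Determines.blockIter t z = (bondShift (F.sitesPerDir_eq (m := F.m) (K := J) (j := 0) (m' := F.m) (K' := J + t) (j' := t) (by omega)) B₀).src ∨ B14.Eq22Determines.blockIter t z = (bondShift (F.sitesPerDir_eq (m := F.m) (K := J) (j := 0) (m' := F.m) (K' := J + t) (j' := t) (by omega)) B₀).tgt) ∧
                ∀ ν, (B10Eq27TorusAxialLog.rel z c.src ν).natAbs ≤ 2 :=
        ⟨c.src, Or.inl hsrc.symm, fun ν => by rw [rel_self]; simp⟩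
      have hle : ‖g c‖ ≤ R B₀ := by
        have := norm_le_pi_norm (fun ℓ' : PBond (F.P (J + t)) 0 =>
          if ∃ z : Site (F.P (J + t)) 0,
                (B14.Eq22Determines.blockIter t z = (bondShift (F.sitesPerDir_eq (m := F.m) (K := J) (j := 0) (m' := F.m) (K' := J + t) (j' := t) (by omega)) B₀).src ∨ B14.Eq22Determines.blockIter t z = (bondShift (F.sitesPerDir_eq (m := F.m) (K := J) (j := 0) (m' := F.m) (K' := J + t) (j' := t) (by omega)) B₀).tgt) ∧
                ∀ ν, (B10Eq27TorusAxialLog.rel z ℓ'.src ν).natAbs ≤ 2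
          then g ℓ' else 0) c
        rwa [if_pos hread] at this
      -- `B₀` is adjacent to `B`: read everything at level `t` of `F.P (J+t)`, through `σ_t` at level `t+1` of `F.P (J+t+1)`
      have hadj : adj B B₀ := by
        refine ⟨rfl, ?_⟩
        have key : ∀ x : Site (F.P J) 0, B14.Eq22Determines.blockIter (t + 1) z = siteShift P₁ x →
            ∀ ν, (rel x ((siteShift P₁').symm y₀) ν).natAbs ≤ r + 3 := by
          intro x hx ν
          have e1 := natAbs_rel_siteShift P₁' x ((siteShift P₁').symm y₀) ν
          rw [(siteShift P₁').apply_symm_apply] at e1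
          have e2 := natAbs_rel_siteShift Ht (siteShift P₁' x) y₀ ν
          rw [siteShift_siteShift] at e2
          have e3 : siteShift (P₁'.trans Ht) x = siteShift Ht (B14.Eq22Determines.blockIter t zp) := by
            rw [← hsucc]; exact hx.symm
          rw [e3, natAbs_rel_siteShift Ht] at e2
          exact e1.symm.le.trans (e2.symm.le.trans (hdist ν))
        rcases hzB with hz | hz
        · exact Or.inl (key B.src hz)
        · exact Or.inr (key B.tgt (hz.trans (bondShift_tgt P₁ B)))
      have hmem : B₀ ∈ univ.filter (adj B) := by rw [mem_filter]; exact ⟨mem_univ _, hadj⟩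
      have hsq : R B₀ ^ 2 ≤ S := by
        rw [hS]
        exact single_le_sum (f := fun B' => R B' ^ 2) (fun B' _ => sq_nonneg (R B')) hmem
      calc ‖g c‖ ≤ R B₀ := hle
        _ ≤ Real.sqrt S := (Real.le_sqrt (hR0 B₀) hS0).mpr hsq
    · rw [if_neg hb, norm_zero]
      exact Real.sqrt_nonneg S
  -- STEP 2: the double count
  have hcard : ∀ B' : PBond (F.P J) 0, ((univ.filter (fun B : PBond (F.P J) 0 => adj B B')).card : ℝ) ≤ ((2 * (F.P J).d * (2 * (r + 3) + 1) ^ (F.P J).d : ℕ) : ℝ) := by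
    intro B'
    have hsub : univ.filter (fun B : PBond (F.P J) 0 => adj B B') ⊆
        univ.filter (fun B : PBond (F.P J) 0 => (∀ ν, (rel B.src B'.src ν).natAbs ≤ r + 3) ∨ (∀ ν, (rel B.tgt B'.src ν).natAbs ≤ r + 3)) := by
      intro B hB
      rw [mem_filter] at hB ⊢
      exact ⟨hB.1, hB.2.2⟩
    have h := (card_le_card hsub).trans (card_bonds_nearBox_le B'.src (r + 3))
    exact_mod_cast h
  calc ∑ B : PBond (F.P J) 0, ‖(fun c : PBond (F.P (J + t)) 0 =>
        if ∃ ℓ' : PBond (F.P (J + (t + 1))) 0, (∃ ℓ'' : PBond (F.P (J + (t + 1))) 0, (∃ z : Site (F.P (J + (t + 1))) 0,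
                (B14.Eq22Determines.blockIter (t + 1) z = (bondShift (F.sitesPerDir_eq (m := F.m) (K := J) (j := 0) (m' := F.m) (K' := J + (t + 1)) (j' := t + 1) (by omega)) B).src ∨ B14.Eq22Determines.blockIter (t + 1) z = (bondShift (F.sitesPerDir_eq (m := F.m) (K := J) (j := 0) (m' := F.m) (K' := J + (t + 1)) (j' := t + 1) (by omega)) B).tgt) ∧
                ∀ ν, (B10Eq27TorusAxialLog.rel z ℓ''.src ν).natAbs ≤ 2) ∧
                (blockOf ℓ'.src = (blockOf ℓ''.src).unshift ℓ''.dir ∨ blockOf ℓ'.src = blockOf ℓ''.src ∨ blockOf ℓ'.src = (blockOf ℓ''.src).shift ℓ''.dir)) ∧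
                ∀ ν, (B10Eq27TorusAxialLog.rel ((siteShift (F.sitesPerDir_eq (m := F.m) (K := J + t) (j := 0) (m' := F.m) (K' := J + (t + 1)) (j' := 1) (by omega))).symm (blockOf ℓ'.src)) c.src ν).natAbs ≤ r
        then g c else 0)‖ ^ 2
      ≤ ∑ B : PBond (F.P J) 0, ∑ B' ∈ univ.filter (adj B), R B' ^ 2 := sum_le_sum fun B _ => h1 B
    _ = ∑ B : PBond (F.P J) 0, ∑ B' : PBond (F.P J) 0, (if adj B B' then R B' ^ 2 else 0) := by
        refine sum_congr rfl fun B _ => ?_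
        rw [sum_filter]
    _ = ∑ B' : PBond (F.P J) 0, ∑ B : PBond (F.P J) 0, (if adj B B' then R B' ^ 2 else 0) := sum_comm
    _ = ∑ B' : PBond (F.P J) 0, ((univ.filter (fun B : PBond (F.P J) 0 => adj B B')).card : ℝ) * R B' ^ 2 := by
        refine sum_congr rfl fun B' _ => ?_
        rw [← sum_filter, sum_const, nsmul_eq_mul]
    _ ≤ ∑ B' : PBond (F.P J) 0, ((2 * (F.P J).d * (2 * (r + 3) + 1) ^ (F.P J).d : ℕ) : ℝ) * R B' ^ 2 :=
        sum_le_sum fun B' _ => mul_le_mul_of_nonneg_right (hcard B') (sq_nonneg _)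
    _ = ((2 * (F.P J).d * (2 * (r + 3) + 1) ^ (F.P J).d : ℕ) : ℝ) * ∑ B' : PBond (F.P J) 0, R B' ^ 2 := by rw [mul_sum]

end Cover

end Summit.QuantumFields.YangMills.Theorems.FluctuationComparisonRegPrIntLS2BetaParentBoxReadCover
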